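import Mathlib.Analysis.SpecialFunctions.Pow.Real
import Mathlib.Algebra.Order.BigOperators.Group.Finset
import Mathlib.Algebra.BigOperators.Field
import HarnessLib

/-!
# Venture YMGap, track ROBUST-BALL (Y2) — crux Y2-X2 for the FULL tier-1 ball, step 2: the finite
# NEUMANN-ITERATE super-solution of a nonnegative matrix with small rows on a finite index set

HONEST FRAMING. WHAT THIS IS: a venture file (cell `pub-ymgap`, track Y2 ROBUST-BALL, seat ds-2); finite
linear algebra with NO lattice content. For a nonnegative array `C x z` on a finite set `S` (off-diagonal action)
with rows `∑_{z ∈ S∖x} C x z ≤ θ < 1` and a nonnegative source `w ≤ M` on `S`, the NEUMANN ITERATES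
`u₀ = 0`, `u_{k+1} = w + C u_k` (`iter C S w k`, zero off `S`) are nonnegative, increasing, bounded by
`M/(1−θ)`, have increments `u_{k+1} − u_k ≤ θ^k M`, and are ADDITIVE and MONOTONE in the source `w`; hence
`U_K = u_K + θ^K M/(1−θ)` (`superSol`) is an explicit SUPER-SOLUTION `w + C U_K ≤ U_K` on `S` — the
substitute for the resolvent `(1 − C)⁻¹ w` that the robust vertex-star door (`RobustBall/RobustStarWindow.lean`)
adds to ds-4's Lemma-G super-solution `dvec` to absorb the off-column cross-Lipschitz entries of a general
tier-1 member, linearly in the boundary link (so that the received sum carries no factor `2d`).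
WHAT THIS IS NOT: no matrix inverse, no spectral statement, no lattice, no number.

## References
* H. Föllmer, LNM 1362 (1988), Ch. I (2.8)–(2.10) (the resolvent as a Neumann series); folklore.
-/

noncomputable section

open Finset

namespace Summit.Ventures.YMGap.StarNeumann

variable {ι : Type*} [DecidableEq ι]

/-- **Neumann iterates** of the off-diagonal array `C` on the finite set `S` with source `w`:
`iter 0 = 0`, `iter (k+1) x = w x + ∑_{z ∈ S∖x} C x z · iter k z` on `S`, `0` off `S`. [folklore] -/
def iter (C : ι → ι → ℝ) (S : Finset ι) (w : ι → ℝ) : ℕ → ι → ℝ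
  | 0 => fun _ => 0
  | k + 1 => fun x => if x ∈ S then w x + ∑ z ∈ S.erase x, C x z * iter C S w k z else 0

variable {C : ι → ι → ℝ} {S : Finset ι} {w w' : ι → ℝ} {θ M : ℝ}

/-- The iterates vanish off `S`. [folklore] -/
theorem iter_of_not_mem (C : ι → ι → ℝ) (w : ι → ℝ) (k : ℕ) {x : ι} (hx : x ∉ S) : iter C S w k x = 0 := by
  cases k with
  | zero => rfl
  | succ k => simp [iter, hx]

/-- The recursion on `S`. [folklore] -/
theorem iter_succ_of_mem (C : ι → ι → ℝ) (w : ι → ℝ) (k : ℕ) {x : ι} (hx : x ∈ S) :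
    iter C S w (k + 1) x = w x + ∑ z ∈ S.erase x, C x z * iter C S w k z := by
  simp [iter, hx]

/-- **Nonnegativity** of the iterates (`C, w ≥ 0`). [folklore] -/
theorem iter_nonneg (hC : ∀ x z, 0 ≤ C x z) (hw : ∀ x, 0 ≤ w x) : ∀ (k : ℕ) (x : ι), 0 ≤ iter C S w k x
  | 0, _ => le_rfl
  | k + 1, x => by
    by_cases hx : x ∈ S
    · rw [iter_succ_of_mem C w k hx]
      exact add_nonneg (hw x) (sum_nonneg fun z _ => mul_nonneg (hC x z) (iter_nonneg hC hw k z))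
    · rw [iter_of_not_mem C w _ hx]

/-- **Increment bound**: `iter (k+1) x − iter k x ≤ θ^k M` when the rows on `S` are `≤ θ` (`θ ≥ 0`) and
`w ≤ M` on `S`. [folklore] -/
theorem iter_succ_sub_le (hC : ∀ x z, 0 ≤ C x z) (hθ0 : 0 ≤ θ) (hrow : ∀ x ∈ S, ∑ z ∈ S.erase x, C x z ≤ θ)
    (hM : ∀ x ∈ S, w x ≤ M) (hM0 : 0 ≤ M) :
    ∀ (k : ℕ) (x : ι), iter C S w (k + 1) x - iter C S w k x ≤ θ ^ k * M
  | 0, x => by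
    by_cases hx : x ∈ S
    · rw [iter_succ_of_mem C w 0 hx]
      simp only [iter, mul_zero, sum_const_zero, add_zero, sub_zero, pow_zero, one_mul]
      exact hM x hx
    · rw [iter_of_not_mem C w _ hx, iter_of_not_mem C w _ hx]; simpa using hM0
  | k + 1, x => by
    by_cases hx : x ∈ S
    · rw [iter_succ_of_mem C w (k + 1) hx, iter_succ_of_mem C w k hx]
      have ih := iter_succ_sub_le hC hθ0 hrow hM hM0 k
      calc w x + ∑ z ∈ S.erase x, C x z * iter C S w (k + 1) z -
            (w x + ∑ z ∈ S.erase x, C x z * iter C S w k z)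
          = ∑ z ∈ S.erase x, C x z * (iter C S w (k + 1) z - iter C S w k z) := by
            rw [add_sub_add_left_eq_sub, ← sum_sub_distrib]
            exact sum_congr rfl fun z _ => by ring
        _ ≤ ∑ z ∈ S.erase x, C x z * (θ ^ k * M) :=
            sum_le_sum fun z _ => mul_le_mul_of_nonneg_left (ih z) (hC x z)
        _ = (∑ z ∈ S.erase x, C x z) * (θ ^ k * M) := by rw [sum_mul]
        _ ≤ θ * (θ ^ k * M) := mul_le_mul_of_nonneg_right (hrow x hx) (by positivity)
        _ = θ ^ (k + 1) * M := by ring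
    · rw [iter_of_not_mem C w _ hx, iter_of_not_mem C w _ hx]
      have : 0 ≤ θ ^ (k + 1) * M := by positivity
      simpa using this

/-- **Uniform bound**: `iter k x ≤ M/(1−θ)` (`0 ≤ θ < 1`, `0 ≤ w ≤ M` on `S`). [folklore] -/
theorem iter_le (hC : ∀ x z, 0 ≤ C x z) (hθ0 : 0 ≤ θ) (hθ1 : θ < 1)
    (hrow : ∀ x ∈ S, ∑ z ∈ S.erase x, C x z ≤ θ) (hM : ∀ x ∈ S, w x ≤ M) (hM0 : 0 ≤ M) :
    ∀ (k : ℕ) (x : ι), iter C S w k x ≤ M / (1 - θ)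
  | 0, x => by simpa [iter] using div_nonneg hM0 (by linarith)
  | k + 1, x => by
    have h1θ : 0 < 1 - θ := by linarith
    by_cases hx : x ∈ S
    · rw [iter_succ_of_mem C w k hx]
      have ih := iter_le hC hθ0 hθ1 hrow hM hM0 k
      calc w x + ∑ z ∈ S.erase x, C x z * iter C S w k z
          ≤ M + ∑ z ∈ S.erase x, C x z * (M / (1 - θ)) :=
            add_le_add (hM x hx) (sum_le_sum fun z _ => mul_le_mul_of_nonneg_left (ih z) (hC x z))
        _ = M + (∑ z ∈ S.erase x, C x z) * (M / (1 - θ)) := by rw [sum_mul]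
        _ ≤ M + θ * (M / (1 - θ)) := by
            have := hrow x hx
            have hMθ : 0 ≤ M / (1 - θ) := div_nonneg hM0 h1θ.le
            nlinarith
        _ = M / (1 - θ) := by field_simp; ring
    · rw [iter_of_not_mem C w _ hx]; exact div_nonneg hM0 h1θ.le

/-- **Additivity in the source**: `iter (w + w') = iter w + iter w'`. [folklore] -/
theorem iter_add (C : ι → ι → ℝ) (S : Finset ι) (w w' : ι → ℝ) :
    ∀ (k : ℕ) (x : ι), iter C S (fun z => w z + w' z) k x = iter C S w k x + iter C S w' k x
  | 0, _ => by simp [iter]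
  | k + 1, x => by
    by_cases hx : x ∈ S
    · rw [iter_succ_of_mem C _ k hx, iter_succ_of_mem C w k hx, iter_succ_of_mem C w' k hx]
      have ih := iter_add C S w w' k
      simp_rw [ih, mul_add, sum_add_distrib]
      ring
    · simp [iter_of_not_mem C _ _ hx]

/-- **Additivity over a finite family of sources**: `iter (∑_{y ∈ Y} w_y) = ∑_{y ∈ Y} iter w_y`. [folklore] -/
theorem iter_sum {κ : Type*} (C : ι → ι → ℝ) (S : Finset ι) (Y : Finset κ) (w : κ → ι → ℝ) (k : ℕ) (x : ι) :
    iter C S (fun z => ∑ y ∈ Y, w y z) k x = ∑ y ∈ Y, iter C S (w y) k x := by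
  classical
  induction Y using Finset.induction_on generalizing x with
  | empty =>
    simp only [sum_empty]
    induction k generalizing x with
    | zero => rfl
    | succ k ih =>
      by_cases hx : x ∈ S
      · rw [iter_succ_of_mem C _ k hx]; simp [ih]
      · rw [iter_of_not_mem C _ _ hx]
  | insert a Y ha ih =>
    simp_rw [sum_insert ha]
    rw [← ih x]
    have h := iter_add C S (w a) (fun z => ∑ y ∈ Y, w y z) k x
    simpa using h

/-- **Monotonicity in the source**: `w ≤ w'` pointwise (and `C ≥ 0`) gives `iter w ≤ iter w'`. [folklore] -/
theorem iter_mono (hC : ∀ x z, 0 ≤ C x z) (hww' : ∀ x, w x ≤ w' x) :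
    ∀ (k : ℕ) (x : ι), iter C S w k x ≤ iter C S w' k x
  | 0, _ => le_rfl
  | k + 1, x => by
    by_cases hx : x ∈ S
    · rw [iter_succ_of_mem C w k hx, iter_succ_of_mem C w' k hx]
      exact add_le_add (hww' x)
        (sum_le_sum fun z _ => mul_le_mul_of_nonneg_left (iter_mono hC hww' k z) (hC x z))
    · rw [iter_of_not_mem C w _ hx, iter_of_not_mem C w' _ hx]

/-- **Scaling**: `iter (t • w) = t · iter w`. [folklore] -/
theorem iter_smul (C : ι → ι → ℝ) (S : Finset ι) (w : ι → ℝ) (t : ℝ) :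
    ∀ (k : ℕ) (x : ι), iter C S (fun z => t * w z) k x = t * iter C S w k x
  | 0, _ => by simp [iter]
  | k + 1, x => by
    by_cases hx : x ∈ S
    · rw [iter_succ_of_mem C _ k hx, iter_succ_of_mem C w k hx]
      have ih := iter_smul C S w t k
      simp_rw [ih, mul_add, mul_sum]
      exact congrArg _ (sum_congr rfl fun z _ => by ring)
    · simp [iter_of_not_mem C _ _ hx]

/-! ### The explicit super-solution -/

/-- **The Neumann super-solution at depth `K`**: `U_K = iter K + θ^K M/(1−θ)` on `S`, `0` off `S`. [folklore] -/
def superSol (C : ι → ι → ℝ) (S : Finset ι) (w : ι → ℝ) (θ M : ℝ) (K : ℕ) (x : ι) : ℝ :=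
  if x ∈ S then iter C S w K x + θ ^ K * M / (1 - θ) else 0

/-- `superSol` vanishes off `S`. [folklore] -/
theorem superSol_of_not_mem (C : ι → ι → ℝ) (w : ι → ℝ) (θ M : ℝ) (K : ℕ) {x : ι} (hx : x ∉ S) :
    superSol C S w θ M K x = 0 := by simp [superSol, hx]

/-- `superSol` on `S`. [folklore] -/
theorem superSol_of_mem (C : ι → ι → ℝ) (w : ι → ℝ) (θ M : ℝ) (K : ℕ) {x : ι} (hx : x ∈ S) :
    superSol C S w θ M K x = iter C S w K x + θ ^ K * M / (1 - θ) := by simp [superSol, hx]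

/-- `superSol ≥ 0`. [folklore] -/
theorem superSol_nonneg (hC : ∀ x z, 0 ≤ C x z) (hw : ∀ x, 0 ≤ w x) (hθ0 : 0 ≤ θ) (hθ1 : θ < 1)
    (hM0 : 0 ≤ M) (K : ℕ) (x : ι) : 0 ≤ superSol C S w θ M K x := by
  unfold superSol
  split_ifs
  · exact add_nonneg (iter_nonneg hC hw K x) (div_nonneg (by positivity) (by linarith))
  · exact le_rfl

/-- **THE SUPER-SOLUTION PROPERTY**: `w x + ∑_{z ∈ S∖x} C x z · U_K z ≤ U_K x` on `S`
(`0 ≤ θ < 1`, rows `≤ θ`, `0 ≤ w ≤ M` on `S`): `w + C·iter K = iter (K+1) ≤ iter K + θ^K M` and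
`C · (θ^K M/(1−θ)) ≤ θ · θ^K M/(1−θ)`. [folklore] -/
theorem superSol_isSuperSolution (hC : ∀ x z, 0 ≤ C x z) (hθ0 : 0 ≤ θ) (hθ1 : θ < 1)
    (hrow : ∀ x ∈ S, ∑ z ∈ S.erase x, C x z ≤ θ) (hM : ∀ x ∈ S, w x ≤ M) (hM0 : 0 ≤ M) (K : ℕ)
    {x : ι} (hx : x ∈ S) :
    w x + ∑ z ∈ S.erase x, C x z * superSol C S w θ M K z ≤ superSol C S w θ M K x := by
  have h1θ : 0 < 1 - θ := by linarith
  rw [superSol_of_mem C w θ M K hx]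
  have hz : ∀ z ∈ S.erase x, C x z * superSol C S w θ M K z =
      C x z * iter C S w K z + C x z * (θ ^ K * M / (1 - θ)) := by
    intro z hz
    rw [superSol_of_mem C w θ M K (mem_of_mem_erase hz)]; ring
  rw [sum_congr rfl hz, sum_add_distrib, ← add_assoc, ← iter_succ_of_mem C w K hx, ← sum_mul]
  have hinc := iter_succ_sub_le hC hθ0 hrow hM hM0 K x
  have hr := hrow x hx
  have hκ : 0 ≤ θ ^ K * M / (1 - θ) := div_nonneg (by positivity) h1θ.le
  calc iter C S w (K + 1) x + (∑ z ∈ S.erase x, C x z) * (θ ^ K * M / (1 - θ))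
      ≤ (iter C S w K x + θ ^ K * M) + θ * (θ ^ K * M / (1 - θ)) := by
        gcongr
        · linarith
    _ = iter C S w K x + θ ^ K * M / (1 - θ) := by field_simp; ring

/-- **Bound**: `U_K x ≤ (M' + θ^K M)/(1−θ)` on all of `ι` whenever also `w ≤ M'` on `S` (used with a sharper
pointwise bound `M'` than the `ℓ¹`-type constant `M` of the correction term). [folklore] -/
theorem superSol_le (hC : ∀ x z, 0 ≤ C x z) (hθ0 : 0 ≤ θ) (hθ1 : θ < 1)
    (hrow : ∀ x ∈ S, ∑ z ∈ S.erase x, C x z ≤ θ) {M' : ℝ} (hM' : ∀ x ∈ S, w x ≤ M') (hM'0 : 0 ≤ M')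
    (hM0 : 0 ≤ M) (K : ℕ) (x : ι) : superSol C S w θ M K x ≤ (M' + θ ^ K * M) / (1 - θ) := by
  have h1θ : 0 < 1 - θ := by linarith
  unfold superSol
  split_ifs with hx
  · have h := iter_le hC hθ0 hθ1 hrow hM' hM'0 K x
    rw [add_div]
    exact add_le_add h le_rfl
  · positivity

/-- **Additivity of the super-solution over a finite family of sources** (same `C, S, θ, K`; the constants
add): `∑_{y ∈ Y} U_K[w_y, M_y] = U_K[∑ w_y, ∑ M_y]`. [folklore] -/
theorem sum_superSol {κ : Type*} (C : ι → ι → ℝ) (S : Finset ι) (Y : Finset κ) (w : κ → ι → ℝ)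
    (θ : ℝ) (Mf : κ → ℝ) (K : ℕ) (x : ι) :
    ∑ y ∈ Y, superSol C S (w y) θ (Mf y) K x =
      superSol C S (fun z => ∑ y ∈ Y, w y z) θ (∑ y ∈ Y, Mf y) K x := by
  unfold superSol
  split_ifs with hx
  · rw [sum_add_distrib, iter_sum, ← Finset.sum_div, ← Finset.mul_sum]
  · simp

/-- **Monotonicity of the super-solution in the source and the constant.** [folklore] -/
theorem superSol_mono (hC : ∀ x z, 0 ≤ C x z) (hθ0 : 0 ≤ θ) (hθ1 : θ < 1) (hww' : ∀ x, w x ≤ w' x)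
    {M M' : ℝ} (hMM' : M ≤ M') (K : ℕ) (x : ι) :
    superSol C S w θ M K x ≤ superSol C S w' θ M' K x := by
  have h1θ : 0 < 1 - θ := by linarith
  unfold superSol
  split_ifs with hx
  · gcongr
    · exact iter_mono hC hww' K x
  · exact le_rfl

end Summit.Ventures.YMGap.StarNeumann

end
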